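import Summits.AtomisticToContinuum.FouriersLaw.Theorems.PhononMeanFreePathDefs
import Summits.AtomisticToContinuum.FouriersLaw.Theorems.BondHeatUncertaintySubdiffusiveBondHeatKernelDetailedBalance
import Summits.AtomisticToContinuum.FouriersLaw.Theorems.PhononMeanFreePathIncoherentChannelLightConeHelper2
import Summits.AtomisticToContinuum.FouriersLaw.Theorems.PhononMeanFreePathIncoherentChannelTimeReversal
import Summits.AtomisticToContinuum.FouriersLaw.Theorems.PhononMeanFreePathIncoherentChannelReflection

/-!
# Time reversal of the power covariance (line `two-horizons-forecast-loss`, crux `IncoherentChannel`)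

Helper file of line `two-horizons-forecast-loss` of crux `PhononMeanFreePath.IncoherentChannel`
(stmt-AtomisticToContinuum-11811), stub group "EnergyTimeReversal" (registered stubs `powerCov_timeReversal`,
`abs_powerCov_two_mul_le_energyForecast`).

Setting: `P = pinnedChain ω₂ lam β γ` (`ω₂, lam, β, γ > 0`), the `(N+1)`-site chain `0..N` with both baths at
`T > 0`, `μ₀ = P.gibbsMeasure (N+1) T` (invariant Gibbs law), `K_t = P.transitionKernel (N+1) T T t⁺` (Markov,
Chapman–Kolmogorov), `Θ(q,p) = (q,-p)`, and the centred end kinetic energies `e_0 = p_0² - T`, `e_N = p_N² - T`.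
The crux kernel `C_N(t) = powerCov … N t = Cov_{μ₀}(p_0², K_t p_N²)` (`Theorems/PhononMeanFreePathDefs`) is the
`L²(μ₀)`-overlap `⟨e_0, K_t e_N⟩` (equipartition `∫ p_0² dμ₀ = T` and invariance `∫ K_t p_N² dμ₀ = T`).

The EVEN-SECTOR TWIN of the time-reversal structure of the mean forecast
(`Theorems/PhononMeanFreePathIncoherentChannelTimeReversal`):

* `powerCov_timeReversal` (registered) — `C_N(s+u) = ⟨(K_u e_0)∘Θ, K_s e_N⟩_{μ₀}` for `s, u ≥ 0`:
  Chapman–Kolmogorov `K_{s+u} p_N² = K_u (K_s p_N²)` (`energyTR_sqForecast_add`), kernel detailed balance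
  `∫ f · (K_u h) dμ₀ = ∫ (h∘Θ) · K_u (f∘Θ) dμ₀` (`SubdiffusiveBondHeat.pinnedChain_detailedBalance`) with `f = p_0²`
  (`Θ`-invariant), `h = K_s p_N²`, and the `Θ`-invariance of `μ₀`;
* `abs_powerCov_two_mul_le_energyForecast` (registered) — `|C_N(2t)| ≤ ‖K_t e_N‖²_{L²(μ₀)}`: Cauchy–Schwarz at
  `s = u = t`, `‖(K_t e_0)∘Θ‖ = ‖K_t e_0‖` (`Θ` preserves `μ₀`) and `‖K_t e_0‖ = ‖K_t e_N‖` by the left–right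
  reflection of the equal-temperature chain (`energyTR_leftEnergyForecastNorm_eq`, after
  `Theorems/PhononMeanFreePathIncoherentChannelReflection`).
-/

noncomputable section

namespace Summit.AtomisticToContinuum.FouriersLaw.Theorems.PhononMeanFreePath

open MeasureTheory Set Filter Topology
open scoped NNReal
open Literature.MathematicalPhysics.KineticTheory.HeatConduction
open Summit.AtomisticToContinuum.FouriersLaw.Theorems.SubdiffusiveBondHeat
  (pinnedChain_detailedBalance pinnedChain_sq_act_le_of_sq_integrable integrable_mul_of_sq_aesm)
open Summit.AtomisticToContinuum.FouriersLaw.Theorems.IncoherentChannel.Negative.KernelMoments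
  (integrable_sq_momentum_transitionKernel)
open Summit.AtomisticToContinuum.FouriersLaw.Theorems.IncoherentChannel.Negative.GibbsStein (gibbs_sq_momentum)
open Summit.AtomisticToContinuum.FouriersLaw.Cruxes.SuperadditiveResistance.FloatingProbeBypassLaplacian
  (integral_flip_gibbsMeasure integrable_flip_gibbsMeasure)
open Summit.AtomisticToContinuum.FouriersLaw.Theorems.OddSectorWitness (transitionKernel_siteReflection)
open Summit.AtomisticToContinuum.FouriersLaw.Theorems.NonBallistic (measurePreserving_siteReflection_gibbsMeasure)

/-! ### Two elementary integral manipulations -/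

/-- On a probability space, `∫ (a - T)(b - T) = ∫ a b - T²` as soon as `a, b, a b ∈ L¹` and `∫ a = ∫ b = T`
(expansion of the centred product). [folklore] -/
theorem energyTR_integral_sub_mul_sub {α : Type*} [MeasurableSpace α] {μ : Measure α} [IsProbabilityMeasure μ]
    {a b : α → ℝ} {T : ℝ} (ha : Integrable a μ) (hb : Integrable b μ) (hab : Integrable (fun z => a z * b z) μ)
    (haT : ∫ z, a z ∂μ = T) (hbT : ∫ z, b z ∂μ = T) :
    ∫ z, (a z - T) * (b z - T) ∂μ = (∫ z, a z * b z ∂μ) - T * T := by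
  have e : (fun z => (a z - T) * (b z - T)) = fun z => (a z * b z - T * a z - T * b z) + T * T := by
    funext z; ring
  have h1 : Integrable (fun z => a z * b z - T * a z) μ := hab.sub (ha.const_mul T)
  have h2 : Integrable (fun z => a z * b z - T * a z - T * b z) μ := h1.sub (hb.const_mul T)
  rw [e, integral_add h2 (integrable_const _), integral_sub h1 (hb.const_mul T), integral_sub hab (ha.const_mul T),
    integral_const_mul, integral_const_mul, integral_const, haT, hbT]
  simp only [probReal_univ, smul_eq_mul, one_mul]
  ring

/-- On a finite measure space, `(a - T)² ∈ L¹` as soon as `a, a² ∈ L¹`. [folklore] -/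
theorem energyTR_integrable_sub_const_sq {α : Type*} [MeasurableSpace α] {μ : Measure α} [IsFiniteMeasure μ]
    {a : α → ℝ} (T : ℝ) (ha2 : Integrable (fun z => a z ^ 2) μ) (ha : Integrable a μ) :
    Integrable (fun z => (a z - T) ^ 2) μ := by
  have e : (fun z => (a z - T) ^ 2) = fun z => (a z ^ 2 - 2 * T * a z) + T ^ 2 := by
    funext z; ring
  have h1 : Integrable (fun z => a z ^ 2 - 2 * T * a z) μ := ha2.sub (ha.const_mul _)
  rw [e]
  exact h1.add (integrable_const _)

/-! ### The energy forecasts `K_t p_i²` -/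

/-- The energy forecast `z ↦ (K_t p_i²)(z)` is a measurable function of the initial microstate (measurability of
kernel integrals). [folklore] -/
theorem energyTR_measurable_sqForecast (ω₂ lam β γ T : ℝ) (N : ℕ) (i : Fin (N + 1)) (t : ℝ) :
    Measurable fun z : PhaseSpace (N + 1) =>
      ∫ y, y.2 i ^ 2 ∂((pinnedChain ω₂ lam β γ).transitionKernel (N + 1) T T t.toNNReal z) := by
  have h : StronglyMeasurable fun y : PhaseSpace (N + 1) => y.2 i ^ 2 :=
    (((measurable_pi_apply i).comp measurable_snd).pow_const 2).stronglyMeasurable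
  exact (h.integral_kernel (κ := (pinnedChain ω₂ lam β γ).transitionKernel (N + 1) T T t.toNNReal)).measurable

section Setting

variable {ω₂ lam β γ T : ℝ} (hω : 0 < ω₂) (hl : 0 < lam) (hβ : 0 < β) (hγ : 0 < γ) (hT : 0 < T)
include hω hl hβ hγ hT

/-- **Moments of the energy forecast under the Gibbs law.** For every site `i` and time `t`:
`K_t p_i² ∈ L¹(μ₀)` with `∫ K_t p_i² dμ₀ = ∫ p_i² dμ₀ = T` (invariance of `μ₀` and equipartition), and
`(K_t p_i²)² ∈ L¹(μ₀)` (kernel Jensen, `p_i⁴ ∈ L¹(μ₀)`). [folklore] -/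
theorem energyTR_sqForecast_moments (N : ℕ) (i : Fin (N + 1)) (t : ℝ) :
    Integrable (fun z => ∫ y, y.2 i ^ 2 ∂((pinnedChain ω₂ lam β γ).transitionKernel (N + 1) T T t.toNNReal z))
        ((pinnedChain ω₂ lam β γ).gibbsMeasure (N + 1) T) ∧
      ∫ z, (∫ y, y.2 i ^ 2 ∂((pinnedChain ω₂ lam β γ).transitionKernel (N + 1) T T t.toNNReal z))
          ∂((pinnedChain ω₂ lam β γ).gibbsMeasure (N + 1) T) = T ∧
      Integrable (fun z => (∫ y, y.2 i ^ 2 ∂((pinnedChain ω₂ lam β γ).transitionKernel (N + 1) T T t.toNNReal z)) ^ 2)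
        ((pinnedChain ω₂ lam β γ).gibbsMeasure (N + 1) T) := by
  have h2 := lightCone_integrable_kernel_integral hω hl.le hβ.le hγ.le hT t.toNNReal
    (g := fun y : PhaseSpace (N + 1) => y.2 i ^ 2) (by fun_prop) (fun y => sq_nonneg _)
    (lightCone_integrable_momentum_pow hω hl.le hβ.le hT i 2)
  have hpm : Measurable fun y : PhaseSpace (N + 1) => y.2 i ^ 2 :=
    ((measurable_pi_apply i).comp measurable_snd).pow_const 2
  have hp4 : Integrable (fun y : PhaseSpace (N + 1) => (y.2 i ^ 2) ^ 2)
      ((pinnedChain ω₂ lam β γ).gibbsMeasure (N + 1) T) :=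
    (lightCone_integrable_momentum_pow hω hl.le hβ.le hT i 4).congr (Eventually.of_forall fun y => by ring)
  obtain ⟨-, hsq, -⟩ := pinnedChain_sq_act_le_of_sq_integrable hω hl hβ hγ (Nat.succ_pos N) hT hpm hp4 t.toNNReal
  exact ⟨h2.1, h2.2.trans (gibbs_sq_momentum hω hl.le hβ.le hT i), hsq⟩

/-- **Chapman–Kolmogorov for the energy forecast**, pointwise: `(K_{s+u} p_i²)(z) = (K_u (K_s p_i²))(z)` for every
microstate `z` and `s, u ≥ 0` (`K_{u+s} = K_s ∘ₖ K_u`, `pinnedChain_transitionKernel_add`, and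
`p_i² ∈ L¹(K_{s+u} z)`). [folklore] -/
theorem energyTR_sqForecast_add (N : ℕ) (i : Fin (N + 1)) {s u : ℝ} (hs : 0 ≤ s) (hu : 0 ≤ u)
    (z : PhaseSpace (N + 1)) :
    ∫ y, y.2 i ^ 2 ∂((pinnedChain ω₂ lam β γ).transitionKernel (N + 1) T T (s + u).toNNReal z) =
      ∫ y, (∫ y', y'.2 i ^ 2 ∂((pinnedChain ω₂ lam β γ).transitionKernel (N + 1) T T s.toNNReal y))
        ∂((pinnedChain ω₂ lam β γ).transitionKernel (N + 1) T T u.toNNReal z) := by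
  rw [add_comm s u, Real.toNNReal_add hu hs,
    pinnedChain_transitionKernel_add hω hl.le hβ.le hγ.le (N + 1) T T u.toNNReal s.toNNReal]
  refine ProbabilityTheory.Kernel.integral_comp ?_
  rw [← pinnedChain_transitionKernel_add hω hl.le hβ.le hγ.le (N + 1) T T u.toNNReal s.toNNReal]
  exact integrable_sq_momentum_transitionKernel hω hl.le hβ.le hγ.le (Nat.succ_pos N) hT _ z _

end Setting

section Reflection

variable {ω₂ lam β γ : ℝ} (hω : 0 < ω₂) (hl : 0 ≤ lam) (hβ : 0 ≤ β) (hγ : 0 ≤ γ)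
include hω hl hβ hγ

/-- **The left energy forecast is the reflected right one**, pointwise: `(K_t p_0²)(R z) = (K_t p_N²)(z)` for the
site reflection `R` of the equal-temperature chain (`K_t(R z, ·) = R_* K_t(z, ·)`, `transitionKernel_siteReflection`,
and `p_0 ∘ R = p_N`; no integrability needed). [folklore] -/
theorem energyTR_leftSqForecast_siteReflection (T : ℝ) (N : ℕ) (t : ℝ) (z : PhaseSpace (N + 1)) :
    ∫ y, y.2 0 ^ 2 ∂((pinnedChain ω₂ lam β γ).transitionKernel (N + 1) T T t.toNNReal (siteReflection (N + 1) z)) =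
      ∫ y, y.2 (Fin.last N) ^ 2 ∂((pinnedChain ω₂ lam β γ).transitionKernel (N + 1) T T t.toNNReal z) := by
  have hR : MeasurableEmbedding (siteReflection (N + 1)) := (siteReflectionEquiv (N + 1)).measurableEmbedding
  rw [transitionKernel_siteReflection hω hl hβ hγ (N + 1) T t.toNNReal z, hR.integral_map]
  simp only [siteReflection_snd, Fin.rev_zero]

/-- **The left and right energy-forecast norms agree**: `‖K_t e_0‖²_{L²(μ₀)} = ‖K_t e_N‖²_{L²(μ₀)}` with
`e_i = p_i² - T`, i.e. `∫ (K_t p_0² - T)² dμ₀ = ∫ (K_t p_N² - T)² dμ₀` (`K_t p_N² = (K_t p_0²) ∘ R` pointwise and `R`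
preserves `μ₀`, `measurePreserving_siteReflection_gibbsMeasure`; no integrability needed). [folklore] -/
theorem energyTR_leftEnergyForecastNorm_eq (T : ℝ) (N : ℕ) (t : ℝ) :
    ∫ z, ((∫ y, y.2 0 ^ 2 ∂((pinnedChain ω₂ lam β γ).transitionKernel (N + 1) T T t.toNNReal z)) - T) ^ 2
        ∂((pinnedChain ω₂ lam β γ).gibbsMeasure (N + 1) T) =
      ∫ z, ((∫ y, y.2 (Fin.last N) ^ 2 ∂((pinnedChain ω₂ lam β γ).transitionKernel (N + 1) T T t.toNNReal z)) - T) ^ 2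
        ∂((pinnedChain ω₂ lam β γ).gibbsMeasure (N + 1) T) := by
  have hR := measurePreserving_siteReflection_gibbsMeasure (pinnedChain ω₂ lam β γ) (pinnedChain_V_neg ω₂ lam β γ)
    (N + 1) T
  symm
  calc ∫ z, ((∫ y, y.2 (Fin.last N) ^ 2 ∂((pinnedChain ω₂ lam β γ).transitionKernel (N + 1) T T t.toNNReal z)) - T) ^ 2
        ∂((pinnedChain ω₂ lam β γ).gibbsMeasure (N + 1) T)
      = ∫ z, ((∫ y, y.2 0 ^ 2 ∂((pinnedChain ω₂ lam β γ).transitionKernel (N + 1) T T t.toNNReal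
          (siteReflection (N + 1) z))) - T) ^ 2 ∂((pinnedChain ω₂ lam β γ).gibbsMeasure (N + 1) T) := by
        simp only [energyTR_leftSqForecast_siteReflection hω hl hβ hγ]
    _ = ∫ z, ((∫ y, y.2 0 ^ 2 ∂((pinnedChain ω₂ lam β γ).transitionKernel (N + 1) T T t.toNNReal z)) - T) ^ 2
          ∂((pinnedChain ω₂ lam β γ).gibbsMeasure (N + 1) T) :=
        hR.integral_comp (siteReflectionEquiv (N + 1)).measurableEmbedding
          (fun z => ((∫ y, y.2 0 ^ 2 ∂((pinnedChain ω₂ lam β γ).transitionKernel (N + 1) T T t.toNNReal z)) - T) ^ 2)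

end Reflection

/-! ### The registered stubs -/

/-- **Time reversal of the power covariance (registered stub `powerCov_timeReversal`).** For the pinned chain with
both baths at `T` and all `s, u ≥ 0`:
`C_N(s+u) = ∫ ((K_u p_0²)(Θz) - T) · ((K_s p_N²)(z) - T) dμ₀(z) = ⟨(K_u e_0)∘Θ, K_s e_N⟩_{L²(μ₀)}`.
Proof: `C_N(s+u) = ∫ p_0² · K_u(K_s p_N²) dμ₀ - T²` (Chapman–Kolmogorov, equipartition, invariance of `μ₀`);
kernel detailed balance with `f = p_0² = p_0²∘Θ` and `h = K_s p_N²` turns the first term into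
`∫ (K_s p_N²)(Θz) (K_u p_0²)(z) dμ₀ = ∫ (K_u p_0²)(Θz) (K_s p_N²)(z) dμ₀` (`Θ` preserves `μ₀`); finally
`∫ (a - T)(b - T) dμ₀ = ∫ a b dμ₀ - T²` since `∫ a = ∫ b = T`. [folklore] -/
theorem powerCov_timeReversal : ∀ ω₂ lam β γ : ℝ, 0 < ω₂ → 0 < lam → 0 < β → 0 < γ → ∀ T : ℝ, 0 < T → ∀ N : ℕ, 1 ≤ N → ∀ s u : ℝ, 0 ≤ s → 0 ≤ u → powerCov ω₂ lam β γ T N (s + u) = ∫ z, ((∫ y, (y.2 0) ^ 2 ∂((pinnedChain ω₂ lam β γ).transitionKernel (N + 1) T T u.toNNReal (z.1, -z.2))) - T) * ((∫ y, (y.2 (Fin.last N)) ^ 2 ∂((pinnedChain ω₂ lam β γ).transitionKernel (N + 1) T T s.toNNReal z)) - T) ∂((pinnedChain ω₂ lam β γ).gibbsMeasure (N + 1) T) := by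
  intro ω₂ lam β γ hω hl hβ hγ T hT N _ s u hs hu
  haveI : IsProbabilityMeasure ((pinnedChain ω₂ lam β γ).gibbsMeasure (N + 1) T) :=
    pinnedChain_isProbabilityMeasure_gibbsMeasure hω hl.le hβ.le γ (N + 1) hT
  -- moments of the right forecast `K_s p_N²`, the left forecast `K_u p_0²`, and `K_{s+u} p_N²`
  obtain ⟨hGi, hGT, hG2⟩ := energyTR_sqForecast_moments hω hl hβ hγ hT N (Fin.last N) s
  obtain ⟨hFi, hFT, hF2⟩ := energyTR_sqForecast_moments hω hl hβ hγ hT N 0 u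
  obtain ⟨-, hKT, -⟩ := energyTR_sqForecast_moments hω hl hβ hγ hT N (Fin.last N) (s + u)
  have hp0T : ∫ z, z.2 0 ^ 2 ∂((pinnedChain ω₂ lam β γ).gibbsMeasure (N + 1) T) = T :=
    gibbs_sq_momentum hω hl.le hβ.le hT 0
  -- the flipped left forecast `(K_u p_0²) ∘ Θ`
  have hFΘi : Integrable (fun z : PhaseSpace (N + 1) => ∫ y, y.2 0 ^ 2
      ∂((pinnedChain ω₂ lam β γ).transitionKernel (N + 1) T T u.toNNReal (z.1, -z.2)))
      ((pinnedChain ω₂ lam β γ).gibbsMeasure (N + 1) T) :=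
    integrable_flip_gibbsMeasure (pinnedChain ω₂ lam β γ) (N + 1) T hFi
  have hFΘT : ∫ z, (∫ y, y.2 0 ^ 2 ∂((pinnedChain ω₂ lam β γ).transitionKernel (N + 1) T T u.toNNReal (z.1, -z.2)))
      ∂((pinnedChain ω₂ lam β γ).gibbsMeasure (N + 1) T) = T := by
    rw [integral_flip_gibbsMeasure (pinnedChain ω₂ lam β γ) (N + 1) T
      (fun z => ∫ y, y.2 0 ^ 2 ∂((pinnedChain ω₂ lam β γ).transitionKernel (N + 1) T T u.toNNReal z))]
    exact hFT
  have hFΘ2 : Integrable (fun z : PhaseSpace (N + 1) => (∫ y, y.2 0 ^ 2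
      ∂((pinnedChain ω₂ lam β γ).transitionKernel (N + 1) T T u.toNNReal (z.1, -z.2))) ^ 2)
      ((pinnedChain ω₂ lam β γ).gibbsMeasure (N + 1) T) :=
    integrable_flip_gibbsMeasure (pinnedChain ω₂ lam β γ) (N + 1) T
      (F := fun z => (∫ y, y.2 0 ^ 2 ∂((pinnedChain ω₂ lam β γ).transitionKernel (N + 1) T T u.toNNReal z)) ^ 2) hF2
  have hprod : Integrable (fun z : PhaseSpace (N + 1) =>
      (∫ y, y.2 0 ^ 2 ∂((pinnedChain ω₂ lam β γ).transitionKernel (N + 1) T T u.toNNReal (z.1, -z.2))) *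
        ∫ y, y.2 (Fin.last N) ^ 2 ∂((pinnedChain ω₂ lam β γ).transitionKernel (N + 1) T T s.toNNReal z))
      ((pinnedChain ω₂ lam β γ).gibbsMeasure (N + 1) T) :=
    integrable_mul_of_sq_aesm hFΘi.aestronglyMeasurable hGi.aestronglyMeasurable hFΘ2 hG2
  -- the key identity `∫ p_0² · K_{s+u} p_N² dμ₀ = ∫ (K_u p_0²)(Θz) · (K_s p_N²)(z) dμ₀`
  have key : ∫ z, z.2 0 ^ 2 * (∫ y, y.2 (Fin.last N) ^ 2
        ∂((pinnedChain ω₂ lam β γ).transitionKernel (N + 1) T T (s + u).toNNReal z))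
        ∂((pinnedChain ω₂ lam β γ).gibbsMeasure (N + 1) T) =
      ∫ z, (∫ y, y.2 0 ^ 2 ∂((pinnedChain ω₂ lam β γ).transitionKernel (N + 1) T T u.toNNReal (z.1, -z.2))) *
        (∫ y, y.2 (Fin.last N) ^ 2 ∂((pinnedChain ω₂ lam β γ).transitionKernel (N + 1) T T s.toNNReal z))
        ∂((pinnedChain ω₂ lam β γ).gibbsMeasure (N + 1) T) := by
    have hpm : Measurable fun z : PhaseSpace (N + 1) => z.2 0 ^ 2 :=
      ((measurable_pi_apply 0).comp measurable_snd).pow_const 2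
    have hp4 : Integrable (fun z : PhaseSpace (N + 1) => (z.2 0 ^ 2) ^ 2)
        ((pinnedChain ω₂ lam β γ).gibbsMeasure (N + 1) T) :=
      (lightCone_integrable_momentum_pow hω hl.le hβ.le hT 0 4).congr (Eventually.of_forall fun z => by ring)
    have hGm := energyTR_measurable_sqForecast ω₂ lam β γ T N (Fin.last N) s
    calc ∫ z, z.2 0 ^ 2 * (∫ y, y.2 (Fin.last N) ^ 2
          ∂((pinnedChain ω₂ lam β γ).transitionKernel (N + 1) T T (s + u).toNNReal z))
          ∂((pinnedChain ω₂ lam β γ).gibbsMeasure (N + 1) T)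
        = ∫ z, z.2 0 ^ 2 * (∫ y, (∫ y', y'.2 (Fin.last N) ^ 2
            ∂((pinnedChain ω₂ lam β γ).transitionKernel (N + 1) T T s.toNNReal y))
            ∂((pinnedChain ω₂ lam β γ).transitionKernel (N + 1) T T u.toNNReal z))
            ∂((pinnedChain ω₂ lam β γ).gibbsMeasure (N + 1) T) := by
          simp only [energyTR_sqForecast_add hω hl hβ hγ hT N (Fin.last N) hs hu]
      _ = ∫ z, (∫ y', y'.2 (Fin.last N) ^ 2
            ∂((pinnedChain ω₂ lam β γ).transitionKernel (N + 1) T T s.toNNReal (z.1, -z.2))) *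
            (∫ y, (fun y : PhaseSpace (N + 1) => y.2 0 ^ 2) (y.1, -y.2)
              ∂((pinnedChain ω₂ lam β γ).transitionKernel (N + 1) T T u.toNNReal z))
            ∂((pinnedChain ω₂ lam β γ).gibbsMeasure (N + 1) T) :=
          pinnedChain_detailedBalance hω hl hβ hγ (Nat.succ_pos N) hT hpm hGm hp4 hG2 u.toNNReal
      _ = ∫ z, (∫ y', y'.2 (Fin.last N) ^ 2
            ∂((pinnedChain ω₂ lam β γ).transitionKernel (N + 1) T T s.toNNReal (z.1, -z.2))) *
            (∫ y, y.2 0 ^ 2 ∂((pinnedChain ω₂ lam β γ).transitionKernel (N + 1) T T u.toNNReal z))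
            ∂((pinnedChain ω₂ lam β γ).gibbsMeasure (N + 1) T) := by
          simp only [Pi.neg_apply, neg_sq]
      _ = ∫ z, (∫ y, y.2 0 ^ 2 ∂((pinnedChain ω₂ lam β γ).transitionKernel (N + 1) T T u.toNNReal (z.1, -z.2))) *
            (∫ y, y.2 (Fin.last N) ^ 2 ∂((pinnedChain ω₂ lam β γ).transitionKernel (N + 1) T T s.toNNReal z))
            ∂((pinnedChain ω₂ lam β γ).gibbsMeasure (N + 1) T) := by
          rw [← integral_flip_gibbsMeasure (pinnedChain ω₂ lam β γ) (N + 1) T (fun z =>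
            (∫ y, y.2 0 ^ 2 ∂((pinnedChain ω₂ lam β γ).transitionKernel (N + 1) T T u.toNNReal (z.1, -z.2))) *
              ∫ y, y.2 (Fin.last N) ^ 2 ∂((pinnedChain ω₂ lam β γ).transitionKernel (N + 1) T T s.toNNReal z))]
          refine integral_congr_ae (Eventually.of_forall fun z => ?_)
          simp only [neg_neg, Prod.mk.eta]
          ring
  unfold powerCov
  rw [key, hp0T, hKT, energyTR_integral_sub_mul_sub hFΘi hGi hprod hFΘT hGT]

/-- **Energy-forecast bound on the power covariance (registered stub `abs_powerCov_two_mul_le_energyForecast`).**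
`|C_N(2t)| ≤ ∫ (K_t p_N² - T)² dμ₀ = ‖K_t e_N‖²_{L²(μ₀)}` for `t ≥ 0`: `powerCov_timeReversal` at `s = u = t`,
Cauchy–Schwarz in `L²(μ₀)` (`timeReversal_sq_integral_mul_le`), `‖(K_t e_0)∘Θ‖ = ‖K_t e_0‖` (`Θ` preserves `μ₀`)
and `‖K_t e_0‖ = ‖K_t e_N‖` (left–right reflection, `energyTR_leftEnergyForecastNorm_eq`). [folklore] -/
theorem abs_powerCov_two_mul_le_energyForecast : ∀ ω₂ lam β γ : ℝ, 0 < ω₂ → 0 < lam → 0 < β → 0 < γ → ∀ T : ℝ, 0 < T → ∀ N : ℕ, 1 ≤ N → ∀ t : ℝ, 0 ≤ t → |powerCov ω₂ lam β γ T N (2 * t)| ≤ ∫ z, ((∫ y, (y.2 (Fin.last N)) ^ 2 ∂((pinnedChain ω₂ lam β γ).transitionKernel (N + 1) T T t.toNNReal z)) - T) ^ 2 ∂((pinnedChain ω₂ lam β γ).gibbsMeasure (N + 1) T) := by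
  intro ω₂ lam β γ hω hl hβ hγ T hT N hN t ht
  rw [two_mul, powerCov_timeReversal ω₂ lam β γ hω hl hβ hγ T hT N hN t t ht ht]
  haveI : IsProbabilityMeasure ((pinnedChain ω₂ lam β γ).gibbsMeasure (N + 1) T) :=
    pinnedChain_isProbabilityMeasure_gibbsMeasure hω hl.le hβ.le γ (N + 1) hT
  obtain ⟨hGi, -, hG2⟩ := energyTR_sqForecast_moments hω hl hβ hγ hT N (Fin.last N) t
  obtain ⟨hFi, -, hF2⟩ := energyTR_sqForecast_moments hω hl hβ hγ hT N 0 t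
  have ha2 : Integrable (fun z : PhaseSpace (N + 1) => ((∫ y, y.2 0 ^ 2
      ∂((pinnedChain ω₂ lam β γ).transitionKernel (N + 1) T T t.toNNReal (z.1, -z.2))) - T) ^ 2)
      ((pinnedChain ω₂ lam β γ).gibbsMeasure (N + 1) T) :=
    integrable_flip_gibbsMeasure (pinnedChain ω₂ lam β γ) (N + 1) T
      (F := fun z => ((∫ y, y.2 0 ^ 2 ∂((pinnedChain ω₂ lam β γ).transitionKernel (N + 1) T T t.toNNReal z)) - T) ^ 2)
      (energyTR_integrable_sub_const_sq T hF2 hFi)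
  have hb2 : Integrable (fun z : PhaseSpace (N + 1) => ((∫ y, y.2 (Fin.last N) ^ 2
      ∂((pinnedChain ω₂ lam β γ).transitionKernel (N + 1) T T t.toNNReal z)) - T) ^ 2)
      ((pinnedChain ω₂ lam β γ).gibbsMeasure (N + 1) T) :=
    energyTR_integrable_sub_const_sq T hG2 hGi
  have hcs := timeReversal_sq_integral_mul_le ha2 hb2
  rw [integral_flip_gibbsMeasure (pinnedChain ω₂ lam β γ) (N + 1) T
      (fun z => ((∫ y, y.2 0 ^ 2 ∂((pinnedChain ω₂ lam β γ).transitionKernel (N + 1) T T t.toNNReal z)) - T) ^ 2),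
    energyTR_leftEnergyForecastNorm_eq hω hl.le hβ.le hγ.le T N t] at hcs
  exact abs_le_of_sq_le_sq (hcs.trans_eq (sq _).symm) (integral_nonneg fun _ => sq_nonneg _)

end Summit.AtomisticToContinuum.FouriersLaw.Theorems.PhononMeanFreePath

end
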